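import Summits.Ventures.HodgeRepro2.T5SU11LegendreBernstein

/-!
# Bernstein's inequality with the sharp constant at every degree: `sin θ · P_n(cos θ)² ≤ 2/(πn)` for all `n ≥ 1`

Row 460 obtained the sharp constant `2/(πn)` at the even degrees and `2/(π(n−1))` at the odd ones. The finer
Wallis bound **`a_m² ≤ 4(m+1)/(π(2m+1)²)`** (`binomHalf_sq_le'`, directly from `W_m ≥ (2m+1)/(2m+2) · π/2`) turns
the odd-degree Sonin–Pólya constant `4(2m+1)² a_m²/((4m+3)² + 1)` into `≤ 16(m+1)/(π((4m+3)² + 1)) ≤ 2/(π(2m+1))`,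
the last step being the integer inequality `8(m+1)(2m+1) ≤ (4m+3)² + 1`. Hence

  **`sin θ · P_n(cos θ)² ≤ 2/(πn)` for every `n ≥ 1` and `θ ∈ (0, π)`**  (`bernstein_sharp`),
  **`√(sin θ) |P_n(cos θ)| ≤ √(2/(πn))`**  (`sqrt_sin_mul_abs_legP_cos_le_sharp`),
  **`(1 − x²)^{1/4} |P_n(x)| ≤ √(2/(πn))` on `(−1, 1)`**  (`sqrt_sqrt_one_sub_sq_mul_abs_legP_le`):

Bernstein's inequality (1931) in its classical sharp form, by Sonin–Pólya and Wallis. Nothing is claimed about (N).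

Blind lane: Mathlib + the HodgeRepro2 prefix only; no sorry; axioms ⊆ {propext, Classical.choice,
Quot.sound}.
-/

namespace Summit.Ventures.HodgeRepro2.T5SU11LegendreBernsteinSharp

open scoped Real
open T5SU11SphericalLegendreAll T5SU11LegendreHeine T5SU11LegendreAtZero T5SU11LegendreSoninPolya
  T5SU11LegendreBernstein

/-- **The finer Wallis bound** `a_m² ≤ 4(m+1)/(π(2m+1)²)` for every `m`. -/
theorem binomHalf_sq_le' (m : ℕ) : binomHalf m ^ 2 ≤ 4 * ((m : ℝ) + 1) / (π * (2 * (m : ℝ) + 1) ^ 2) := by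
  have hπ := Real.pi_pos
  have hW := Real.Wallis.le_W m
  have hWpos := Real.Wallis.W_pos m
  have hid := binomHalf_sq_mul_wallis m
  have hden : 0 < (2 * (m : ℝ) + 1) * Real.Wallis.W m := by positivity
  have ha : binomHalf m ^ 2 = 1 / ((2 * (m : ℝ) + 1) * Real.Wallis.W m) := by
    rw [eq_div_iff hden.ne']
    exact hid
  rw [ha]
  have hlow : π * (2 * (m : ℝ) + 1) ^ 2 / (4 * ((m : ℝ) + 1)) ≤ (2 * (m : ℝ) + 1) * Real.Wallis.W m := by
    calc π * (2 * (m : ℝ) + 1) ^ 2 / (4 * ((m : ℝ) + 1))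
        = (2 * (m : ℝ) + 1) * ((2 * (m : ℝ) + 1) / (2 * m + 2) * (π / 2)) := by
          field_simp
          ring
      _ ≤ (2 * (m : ℝ) + 1) * Real.Wallis.W m := mul_le_mul_of_nonneg_left hW (by positivity)
  calc 1 / ((2 * (m : ℝ) + 1) * Real.Wallis.W m)
      ≤ 1 / (π * (2 * (m : ℝ) + 1) ^ 2 / (4 * ((m : ℝ) + 1))) := one_div_le_one_div_of_le (by positivity) hlow
    _ = 4 * ((m : ℝ) + 1) / (π * (2 * (m : ℝ) + 1) ^ 2) := by
        field_simp

/-- The odd-degree Sonin–Pólya constant is `≤ 2/(π(2m+1))`. -/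
theorem sonin_bound_odd_sharp (m : ℕ) :
    legP (2 * m + 1) 0 ^ 2 + 4 * legQ (2 * m + 1) 0 ^ 2 / ((2 * ((2 * m + 1 : ℕ) : ℝ) + 1) ^ 2 + 1)
      ≤ 2 / (π * ((2 * m + 1 : ℕ) : ℝ)) := by
  have hπ := Real.pi_pos
  rw [legP_zero_odd, sq_legQ_zero_odd, zero_pow two_ne_zero, zero_add]
  push_cast
  have ha := binomHalf_sq_le' m
  have hm : (0 : ℝ) ≤ m := Nat.cast_nonneg m
  have hpos : 0 < (2 * (2 * (m : ℝ) + 1) + 1) ^ 2 + 1 := by positivity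
  have h2 : 0 < 2 * (m : ℝ) + 1 := by positivity
  -- `4 (2m+1)² a_m² ≤ 16 (m+1)/π`
  have h3 : 4 * ((2 * (m : ℝ) + 1) ^ 2 * binomHalf m ^ 2) ≤ 16 * ((m : ℝ) + 1) / π := by
    calc 4 * ((2 * (m : ℝ) + 1) ^ 2 * binomHalf m ^ 2)
        ≤ 4 * ((2 * (m : ℝ) + 1) ^ 2 * (4 * ((m : ℝ) + 1) / (π * (2 * (m : ℝ) + 1) ^ 2))) := by
          gcongr
      _ = 16 * ((m : ℝ) + 1) / π := by
          field_simp
          norm_num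
  -- and `16 (m+1)/(π ((4m+3)² + 1)) ≤ 2/(π (2m+1))`, i.e. `16 (m+1)(2m+1) ≤ 2((4m+3)² + 1)`
  rw [div_le_div_iff₀ hpos (by positivity)]
  calc 4 * ((2 * (m : ℝ) + 1) ^ 2 * binomHalf m ^ 2) * (π * (2 * (m : ℝ) + 1))
      ≤ 16 * ((m : ℝ) + 1) / π * (π * (2 * (m : ℝ) + 1)) :=
        mul_le_mul_of_nonneg_right h3 (by positivity)
    _ = 16 * ((m : ℝ) + 1) * (2 * (m : ℝ) + 1) := by
        field_simp
    _ ≤ 2 * ((2 * (2 * (m : ℝ) + 1) + 1) ^ 2 + 1) := by nlinarith [hm]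

/-- **BERNSTEIN'S INEQUALITY, sharp constant at every degree**: `sin θ · P_n(cos θ)² ≤ 2/(πn)` for `n ≥ 1`. -/
theorem bernstein_sharp {n : ℕ} (hn : 1 ≤ n) {θ : ℝ} (h0 : 0 < θ) (hπ : θ < π) :
    Real.sin θ * legP n (Real.cos θ) ^ 2 ≤ 2 / (π * n) := by
  obtain ⟨m, hm | hm⟩ := Nat.even_or_odd' n
  · subst hm
    have hm1 : 1 ≤ m := by omega
    have h := bernstein_even hm1 h0 hπ
    exact_mod_cast h
  · subst hm
    have h := sin_mul_sq_legP_cos_le (2 * m + 1) h0 hπ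
    have h' := sonin_bound_odd_sharp m
    push_cast at h h' ⊢
    exact le_trans h h'

/-- **`√(sin θ) |P_n(cos θ)| ≤ √(2/(πn))`** for every `n ≥ 1`. -/
theorem sqrt_sin_mul_abs_legP_cos_le_sharp {n : ℕ} (hn : 1 ≤ n) {θ : ℝ} (h0 : 0 < θ) (hπ : θ < π) :
    Real.sqrt (Real.sin θ) * |legP n (Real.cos θ)| ≤ Real.sqrt (2 / (π * n)) := by
  have hs : 0 ≤ Real.sin θ := Real.sin_nonneg_of_nonneg_of_le_pi h0.le hπ.le
  rw [← Real.sqrt_sq_eq_abs, ← Real.sqrt_mul hs]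
  exact Real.sqrt_le_sqrt (bernstein_sharp hn h0 hπ)

/-- **`(1 − x²)^{1/4} |P_n(x)| ≤ √(2/(πn))`** on `(−1, 1)`, `n ≥ 1`. -/
theorem sqrt_sqrt_one_sub_sq_mul_abs_legP_le {n : ℕ} (hn : 1 ≤ n) {x : ℝ} (hx1 : -1 < x) (hx2 : x < 1) :
    Real.sqrt (Real.sqrt (1 - x ^ 2)) * |legP n x| ≤ Real.sqrt (2 / (π * n)) := by
  have h := sqrt_sin_mul_abs_legP_cos_le_sharp hn (θ := Real.arccos x) (Real.arccos_pos.mpr hx2)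
    (Real.arccos_lt_pi.mpr hx1)
  rwa [Real.sin_arccos, Real.cos_arccos hx1.le hx2.le] at h

end Summit.Ventures.HodgeRepro2.T5SU11LegendreBernsteinSharp
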